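import Summits.CriticalPhenomena.PercolationContinuityZ3.Theorems.PercNearOneGluingNoHeavyLowerTailJBernSunflowerKleitmanCross
import Mathlib.LinearAlgebra.FiniteDimensional.Lemmas
import HarnessLib

/-!
# `NoHeavyLowerTail` (crux stmt-CriticalPhenomena-4575), hull-port line hp-7: SUNFLOWER–KLEITMAN (W-Λ) FOR EVERY ACYCLIC ORIENTATION, III —
# full row rank of the source × target matrix and the counting theorem

Support file (prover `prim-hp-7`, generation 49; `--supports stmt-CriticalPhenomena-4575`).  No definitions, no `sorry`, standard axioms.
Memo: `prim-hp-7/FROM-prim-hp-7-g49-WLAMBDA-ACYCLIC.md`.  Part 3 of 3 (after `…Gram`, `…Cross`).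

SETTING (all three files).  A monotone labelling of the cube `2^α` by `⊤` (the up-set `K`), `⊥` (the down-set `D`, disjoint from `K`) and
finitely many middle labels, encoded by a rank function `ρ` that is constant along inclusions inside the middle zone (`hρ`): the classes
`{x ∉ K ∪ D : ρ x = c}` are the PETALS of a sunflower of up-sets `G_c = K ∪ petal_c` with kernel `K` (memo g48 §2: "sunflower–Kleitman" = hp-7's
W-Λ rows = an increasing-injection form of Gladkov's strong Harris–Kleitman inequality).  SOURCES: `ζ` with `ζ, univ∖ζ` both middle and
`ρ ζ < ρ (univ∖ζ)` (an oriented pair of distinct petals, the orientation being ACYCLIC = along `ρ`); TARGETS: `ζ ∈ K` with `univ∖ζ ∈ D`.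
THE THEOREM (file `…Acyclic`, `JBern.card_filter_source_le_card_filter_target`): for every up-set `𝒰`, `#(sources ∩ 𝒰) ≤ #(targets ∩ 𝒰)`.
METHOD: the `sources × targets` matrix `A[s,t] = #{C ∈ G_{ρ(univ∖s)} : univ∖t ⊆ C ⊆ univ∖s} (mod 2)` is supported on `s ⊆ t` and has FULL ROW
RANK over `GF(2)`; pairing its rows with the test vectors `y_{s₀}[t] = #{R : univ∖t ⊆ R ⊆ univ∖s₀, univ∖R ∈ G_{ρ(univ∖s₀)}}` gives the Gram
entries `[s = s₀]` for sources with the same head (F1, this file: prim-l12-p2's parity lemma `Ξ² = I`, `HallGladkov.gam_del_sum`, transposed through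
`mul_eq_one_comm`, plus the vanishing of the rows off the target columns) and `0` for different heads unless `ρ s₀ = ρ(univ∖s)` (F2, file `…Cross`);
so a vanishing combination of rows dies along `ρ` (file `…Acyclic`), and rows inside an up-set being supported on columns inside it, the counting
inequality is a `finrank` comparison.
THIS FILE: `source_rows_independent` (elimination along `ρ` using F1/F2) and **`card_filter_source_le_card_filter_target`**: for an up-set `K`,
a down-set `D` disjoint from it, a middle rank `ρ` constant along middle inclusions, and every up-set `𝒰`:
  `#{ζ ∈ 𝒰 : ζ, univ∖ζ ∉ K ∪ D, ρ ζ < ρ(univ∖ζ)} ≤ #{ζ ∈ 𝒰 : ζ ∈ K, univ∖ζ ∈ D}`.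
With ONE oriented pair of petals this is the mixed Harris row `JBern.card_inter_upper_lower_compls_le` (p259035); with three petals it is the six
TRANSITIVELY oriented W-Λ rows `N^𝒰(X₁,Y₁)+N^𝒰(X₂,Y₂)+N^𝒰(X₃,Y₃) ≤ N^𝒰(T,PM)` of the J-BERN⁺ fibre analysis (memos prim-hp-7 g46 §4.5, g48 §2: conjectured,
exhaustively checked for `|α| ≤ 4` there and `|α| ≤ 5` in g49); in general it is the Hall / increasing-injection form of Gladkov's strong Harris–Kleitman
inequality [arXiv:2305.02653, Thm 2.1] for all acyclic orientations and any number of petals.  The two CYCLICALLY oriented rows of three petals stay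
open (the `GF(2)` matrix can be rank-deficient there from `|α| = 6` on; memo §4). [this work]
-/

namespace Summit.CriticalPhenomena.PercolationContinuityZ3.Theorems.JBern

open Finset
open Summit.CriticalPhenomena.PercolationContinuityZ3.Theorems.SunflowerPartition.HallGladkov

variable {α : Type*} [Fintype α] [DecidableEq α]

/-! ## 3. Full row rank of the source × target matrix, and the counting theorem -/

section Main

variable (K D : Finset (Finset α)) (ρ : Finset α → ℕ)

/-- The matrix entry `A[s,t] = δ_{G}(univ∖s, univ∖t)` is supported on `s ⊆ t`. [this work] -/
theorem row_entry_eq_zero_of_not_subset (G : Finset (Finset α)) {s t : Finset α} (hst : ¬ s ⊆ t) :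
    (∑ C ∈ (univ : Finset α).powerset, (if C ∈ G ∧ univ \ t ⊆ C ∧ C ⊆ univ \ s then (1 : ZMod 2) else 0)) = 0 := by
  refine sum_eq_zero fun C _ => ?_
  rw [if_neg]
  rintro ⟨-, h1, h2⟩
  apply hst
  intro x hx
  by_contra hxt
  exact (mem_sdiff.1 ((h1.trans h2) (mem_sdiff.2 ⟨mem_univ x, hxt⟩))).2 hx

/-- **The source rows are linearly independent over `GF(2)`** (this work).  If a combination `λ` of the rows
`A[s,·] = δ_{G_{ρ(univ∖s)}}(univ∖s, univ∖·)` (over all sources `s`) vanishes on every target column, then `λ = 0` on the sources.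
Proof: pair with the test vector of a source `s₀`; by (F1)/(F2) only `s₀` itself and the sources `s` with `ρ(univ∖s) = ρ s₀ > ρ s` survive,
so `λ s₀` is a combination of `λ s` with smaller `ρ s` — strong induction on `ρ`. [this work] -/
theorem source_rows_independent (hK : IsUpperSet (K : Set (Finset α))) (hD : IsLowerSet (D : Set (Finset α))) (hKD : Disjoint K D)
    (hρ : ∀ s t : Finset α, s ⊆ t → s ∉ D → t ∉ K → ρ s = ρ t) (lam : Finset α → ZMod 2)
    (hlam : ∀ t ∈ (univ : Finset α).powerset.filter (fun t => t ∈ K ∧ univ \ t ∈ D),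
      (∑ s ∈ (univ : Finset α).powerset.filter (fun s => s ∉ K ∧ s ∉ D ∧ univ \ s ∉ K ∧ univ \ s ∉ D ∧ ρ s < ρ (univ \ s)),
        lam s * (∑ C ∈ (univ : Finset α).powerset,
          (if C ∈ ((univ : Finset (Finset α)).filter fun x => x ∈ K ∨ (x ∉ D ∧ ρ x = ρ (univ \ s))) ∧ univ \ t ⊆ C ∧ C ⊆ univ \ s
            then (1 : ZMod 2) else 0))) = 0) :
    ∀ s ∈ (univ : Finset α).powerset.filter (fun s => s ∉ K ∧ s ∉ D ∧ univ \ s ∉ K ∧ univ \ s ∉ D ∧ ρ s < ρ (univ \ s)), lam s = 0 := by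
  set Src := (univ : Finset α).powerset.filter (fun s => s ∉ K ∧ s ∉ D ∧ univ \ s ∉ K ∧ univ \ s ∉ D ∧ ρ s < ρ (univ \ s)) with hSrc
  set Tg := (univ : Finset α).powerset.filter (fun t => t ∈ K ∧ univ \ t ∈ D) with hTg
  -- strong induction on `ρ s`
  suffices h : ∀ m : ℕ, ∀ s ∈ Src, ρ s = m → lam s = 0 from fun s hs => h (ρ s) s hs rfl
  intro m
  induction m using Nat.strong_induction_on with
  | _ m ih =>
  intro s₀ hs₀ hm
  have hs₀' := (mem_filter.1 hs₀).2
  obtain ⟨hs₀K, hs₀D, hs₀cK, hs₀cD, hlt₀⟩ := hs₀'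
  -- the Gram entries against the test vector of `s₀`
  have hX : ∀ s ∈ Src,
      lam s * (∑ t ∈ Tg,
        (∑ C ∈ (univ : Finset α).powerset,
          (if C ∈ ((univ : Finset (Finset α)).filter fun x => x ∈ K ∨ (x ∉ D ∧ ρ x = ρ (univ \ s))) ∧ univ \ t ⊆ C ∧ C ⊆ univ \ s
            then (1 : ZMod 2) else 0)) *
        (∑ R ∈ (univ : Finset α).powerset,
          (if univ \ t ⊆ R ∧ R ⊆ univ \ s₀ ∧ univ \ R ∈ ((univ : Finset (Finset α)).filter fun x => x ∈ K ∨ (x ∉ D ∧ ρ x = ρ (univ \ s₀)))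
            then (1 : ZMod 2) else 0)))
      = if s = s₀ then lam s₀ else 0 := by
    intro s hs
    obtain ⟨hsK, hsD, hscK, hscD, hlt⟩ := (mem_filter.1 hs).2
    by_cases hhead : ρ (univ \ s) = ρ (univ \ s₀)
    · -- same head: (F1)
      have h1 := gram_same_head K D ρ hK hD hKD hρ (ρ (univ \ s₀)) hsK hsD hscK hscD hlt hhead hs₀K hs₀cD hlt₀ rfl
      rw [hhead, h1]
      by_cases hss : s = s₀
      · subst hss; simp
      · rw [if_neg hss, if_neg hss, mul_zero]
    · by_cases htail : ρ s₀ = ρ (univ \ s)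
      · -- `s` feeds into `s₀`: smaller `ρ`, induction hypothesis
        have hss : s ≠ s₀ := fun h => hhead (by rw [h])
        have hlt' : ρ s < m := by rw [← hm, htail]; exact hlt
        rw [ih (ρ s) hlt' s hs rfl, zero_mul, if_neg hss]
      · -- (F2)
        have hss : s ≠ s₀ := fun h => hhead (by rw [h])
        rw [gram_cross_eq_zero K D ρ hK hD hρ hscK hscD hs₀D hs₀cK hs₀cD hlt₀ hhead htail, mul_zero, if_neg hss]
  -- pair the vanishing combination with the test vector of `s₀`
  have hsum : (∑ t ∈ Tg, (∑ s ∈ Src,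
        lam s * (∑ C ∈ (univ : Finset α).powerset,
          (if C ∈ ((univ : Finset (Finset α)).filter fun x => x ∈ K ∨ (x ∉ D ∧ ρ x = ρ (univ \ s))) ∧ univ \ t ⊆ C ∧ C ⊆ univ \ s
            then (1 : ZMod 2) else 0))) *
        (∑ R ∈ (univ : Finset α).powerset,
          (if univ \ t ⊆ R ∧ R ⊆ univ \ s₀ ∧ univ \ R ∈ ((univ : Finset (Finset α)).filter fun x => x ∈ K ∨ (x ∉ D ∧ ρ x = ρ (univ \ s₀)))
            then (1 : ZMod 2) else 0))) = 0 :=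
    sum_eq_zero fun t ht => by rw [hlam t ht, zero_mul]
  rw [show (∑ t ∈ Tg, (∑ s ∈ Src,
        lam s * (∑ C ∈ (univ : Finset α).powerset,
          (if C ∈ ((univ : Finset (Finset α)).filter fun x => x ∈ K ∨ (x ∉ D ∧ ρ x = ρ (univ \ s))) ∧ univ \ t ⊆ C ∧ C ⊆ univ \ s
            then (1 : ZMod 2) else 0))) *
        (∑ R ∈ (univ : Finset α).powerset,
          (if univ \ t ⊆ R ∧ R ⊆ univ \ s₀ ∧ univ \ R ∈ ((univ : Finset (Finset α)).filter fun x => x ∈ K ∨ (x ∉ D ∧ ρ x = ρ (univ \ s₀)))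
            then (1 : ZMod 2) else 0)))
      = ∑ s ∈ Src, lam s * (∑ t ∈ Tg,
        (∑ C ∈ (univ : Finset α).powerset,
          (if C ∈ ((univ : Finset (Finset α)).filter fun x => x ∈ K ∨ (x ∉ D ∧ ρ x = ρ (univ \ s))) ∧ univ \ t ⊆ C ∧ C ⊆ univ \ s
            then (1 : ZMod 2) else 0)) *
        (∑ R ∈ (univ : Finset α).powerset,
          (if univ \ t ⊆ R ∧ R ⊆ univ \ s₀ ∧ univ \ R ∈ ((univ : Finset (Finset α)).filter fun x => x ∈ K ∨ (x ∉ D ∧ ρ x = ρ (univ \ s₀)))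
            then (1 : ZMod 2) else 0))) from by
      rw [show (∑ t ∈ Tg, (∑ s ∈ Src,
        lam s * (∑ C ∈ (univ : Finset α).powerset,
          (if C ∈ ((univ : Finset (Finset α)).filter fun x => x ∈ K ∨ (x ∉ D ∧ ρ x = ρ (univ \ s))) ∧ univ \ t ⊆ C ∧ C ⊆ univ \ s
            then (1 : ZMod 2) else 0))) *
        (∑ R ∈ (univ : Finset α).powerset,
          (if univ \ t ⊆ R ∧ R ⊆ univ \ s₀ ∧ univ \ R ∈ ((univ : Finset (Finset α)).filter fun x => x ∈ K ∨ (x ∉ D ∧ ρ x = ρ (univ \ s₀)))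
            then (1 : ZMod 2) else 0)))
        = ∑ t ∈ Tg, ∑ s ∈ Src, lam s * ((∑ C ∈ (univ : Finset α).powerset,
          (if C ∈ ((univ : Finset (Finset α)).filter fun x => x ∈ K ∨ (x ∉ D ∧ ρ x = ρ (univ \ s))) ∧ univ \ t ⊆ C ∧ C ⊆ univ \ s
            then (1 : ZMod 2) else 0)) *
        (∑ R ∈ (univ : Finset α).powerset,
          (if univ \ t ⊆ R ∧ R ⊆ univ \ s₀ ∧ univ \ R ∈ ((univ : Finset (Finset α)).filter fun x => x ∈ K ∨ (x ∉ D ∧ ρ x = ρ (univ \ s₀)))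
            then (1 : ZMod 2) else 0))) from
        sum_congr rfl fun t _ => by rw [Finset.sum_mul]; exact sum_congr rfl fun s _ => mul_assoc _ _ _]
      rw [Finset.sum_comm]
      exact sum_congr rfl fun s _ => by rw [Finset.mul_sum]] at hsum
  rw [sum_congr rfl hX, Finset.sum_ite_eq' Src s₀, if_pos hs₀] at hsum
  exact hsum

end Main

section Counting

variable (K D : Finset (Finset α)) (ρ : Finset α → ℕ)

/-- **SUNFLOWER–KLEITMAN (W-Λ) FOR ACYCLIC ORIENTATIONS** (this work).  Let `K` be an up-set and `D` a down-set of the cube `2^α`,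
disjoint, and let `ρ : 2^α → ℕ` be constant along every inclusion `s ⊆ t` with `s ∉ D`, `t ∉ K` (so the classes `{x ∉ K ∪ D : ρ x = c}` are
the petals of a sunflower of up-sets with kernel `K`, and `ρ` is an acyclic orientation of the petals).  Then for every up-set `𝒰` the SOURCES
`ζ ∈ 𝒰` (`ζ, univ∖ζ ∉ K ∪ D`, `ρ ζ < ρ (univ∖ζ)`) are at most as many as the TARGETS `ζ ∈ 𝒰` (`ζ ∈ K`, `univ∖ζ ∈ D`):
`#{ζ ∈ 𝒰 : source} ≤ #{ζ ∈ 𝒰 : target}` — equivalently (Hall) the sources inject into the targets along `⊆`.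
With one oriented pair of petals this is the mixed Harris row `JBern.card_inter_upper_lower_compls_le`; with three petals it gives the six
transitively oriented W-Λ rows `N^𝒰(X₁,Y₁)+N^𝒰(X₂,Y₂)+N^𝒰(X₃,Y₃) ≤ N^𝒰(T,PM)` of the J-BERN⁺ fibre analysis (memos prim-hp-7 g46 §4.5, g48 §2).
Proof: `source_rows_independent` inside `𝒰` (rows in an up-set are supported on columns in it) and a `finrank` comparison. [this work] -/
theorem card_filter_source_le_card_filter_target (hK : IsUpperSet (K : Set (Finset α))) (hD : IsLowerSet (D : Set (Finset α)))
    (hKD : Disjoint K D) (hρ : ∀ s t : Finset α, s ⊆ t → s ∉ D → t ∉ K → ρ s = ρ t)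
    (𝒰 : Finset (Finset α)) (h𝒰 : IsUpperSet (𝒰 : Set (Finset α))) :
    #(𝒰.filter fun ζ => ζ ∉ K ∧ ζ ∉ D ∧ univ \ ζ ∉ K ∧ univ \ ζ ∉ D ∧ ρ ζ < ρ (univ \ ζ))
      ≤ #(𝒰.filter fun ζ => ζ ∈ K ∧ univ \ ζ ∈ D) := by
  classical
  set P := 𝒰.filter (fun ζ => ζ ∉ K ∧ ζ ∉ D ∧ univ \ ζ ∉ K ∧ univ \ ζ ∉ D ∧ ρ ζ < ρ (univ \ ζ)) with hP
  set Q := 𝒰.filter (fun ζ => ζ ∈ K ∧ univ \ ζ ∈ D) with hQ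
  set Src := (univ : Finset α).powerset.filter (fun s => s ∉ K ∧ s ∉ D ∧ univ \ s ∉ K ∧ univ \ s ∉ D ∧ ρ s < ρ (univ \ s)) with hSrc
  set Tg := (univ : Finset α).powerset.filter (fun t => t ∈ K ∧ univ \ t ∈ D) with hTg
  have hPS : P ⊆ Src := by
    intro s hs; rw [mem_filter] at hs ⊢; exact ⟨mem_powerset.2 (subset_univ s), hs.2⟩
  let M : Matrix Q P (ZMod 2) := Matrix.of fun t s =>
    ∑ C ∈ (univ : Finset α).powerset,
      (if C ∈ ((univ : Finset (Finset α)).filter fun x => x ∈ K ∨ (x ∉ D ∧ ρ x = ρ (univ \ s.1))) ∧ univ \ t.1 ⊆ C ∧ C ⊆ univ \ s.1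
        then (1 : ZMod 2) else 0)
  have hinj : Function.Injective (Matrix.mulVecLin M) := by
    rw [← LinearMap.ker_eq_bot, LinearMap.ker_eq_bot']
    intro g hg
    let lam : Finset α → ZMod 2 := fun s => if h : s ∈ P then g ⟨s, h⟩ else 0
    have hlamP : ∀ x : P, g x = lam x.1 := fun x => by simp only [lam, dif_pos x.2]
    have hlam0 : ∀ s, s ∉ P → lam s = 0 := fun s hs => by simp only [lam, dif_neg hs]
    have hlam : ∀ t ∈ Tg,
        (∑ s ∈ Src, lam s * (∑ C ∈ (univ : Finset α).powerset,
          (if C ∈ ((univ : Finset (Finset α)).filter fun x => x ∈ K ∨ (x ∉ D ∧ ρ x = ρ (univ \ s))) ∧ univ \ t ⊆ C ∧ C ⊆ univ \ s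
            then (1 : ZMod 2) else 0))) = 0 := by
      intro t ht
      -- the sum over `Src` is the sum over `P`
      rw [← Finset.sum_subset hPS (fun s _ hsP => by rw [hlam0 s hsP, zero_mul])]
      by_cases htU : t ∈ 𝒰
      · have htQ : t ∈ Q := mem_filter.2 ⟨htU, (mem_filter.1 ht).2⟩
        have h0 : (M.mulVec g) ⟨t, htQ⟩ = 0 := by
          have := congrFun (show M.mulVec g = 0 from (Matrix.mulVecLin_apply M g).symm.trans hg) ⟨t, htQ⟩
          exact this
        simp only [Matrix.mulVec, dotProduct, M, Matrix.of_apply] at h0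
        rw [← Finset.sum_coe_sort P]
        refine Eq.trans (sum_congr rfl fun x _ => ?_) h0
        rw [hlamP x, mul_comm]
      · -- rows in `𝒰` are supported on columns in `𝒰`
        refine sum_eq_zero fun s hs => ?_
        have hsU : s ∈ 𝒰 := (mem_filter.1 hs).1
        have hst : ¬ s ⊆ t := fun h => htU (h𝒰 h hsU)
        rw [row_entry_eq_zero_of_not_subset _ hst, mul_zero]
    have hz := source_rows_independent K D ρ hK hD hKD hρ lam hlam
    funext x
    rw [hlamP x, Pi.zero_apply]
    exact hz x.1 (hPS x.2)
  have hle := LinearMap.finrank_le_finrank_of_injective hinj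
  rw [Module.finrank_fintype_fun_eq_card, Module.finrank_fintype_fun_eq_card, Fintype.card_coe, Fintype.card_coe] at hle
  exact hle

end Counting

end Summit.CriticalPhenomena.PercolationContinuityZ3.Theorems.JBern
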